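import Literature.Computability.QuantumComplexity.ForrelationMemEval
import HarnessLib

/-!
# Explicit `k`-fold Forrelation is in `PromiseBQP`, IV: the phase machine and its specification

Fourth file of the instantiation: the mode-multiplexed function `ForrMem.Fn` of the phase machine
(dispatch of `ForrelationMemFields.lean` over the answers `GwF`, `GkF`, `GphaseF`, `GzF` of
`ForrelationMemEval.lean`, each composed with the field extraction), its membership in `FP`, a
machine for it (`RevClean.exists_outputsWithin_pow_of_mem_FP`), the parameters `ForrMem.params`
(`8` spare query wires per copy, no spare layer) and the specification `ForrMem.spec : Spec params`
of `PhaseQueryState.lean` — so that all of `PhaseQuery*.lean` applies: the family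
`PhaseQuery.family params` is uniform, oracle-free, and accepts `x` with probability
`1 − (1 − |⟨0|phiFin⟩|²)³` (`PhaseQuery.acceptProbOn_family`).

## References

* S. Aaronson, A. Ambainis, *Forrelation*, SIAM J. Comput. 47 (2018), §6 (p. 26) [AaronsonAmbainis2018].
* S. Arora, B. Barak, *Computational Complexity: A Modern Approach*, CUP 2009, §1.3 [AroraBarak2009].
-/

noncomputable section

namespace Literature.Computability.QuantumComplexity

open _root_.Computability Polynomial Complexity Complexity.Brick Plumb

namespace ForrMem

open PhaseQuery

/-! ### The function of the phase machine -/

/-- Mode `W`: the answer `GwF` on the input field. [folklore] -/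
def WmodeF : List Bool → List Bool := GwF ∘ xF
/-- Mode `K`: the answer `GkF` on the input field. [folklore] -/
def KmodeF : List Bool → List Bool := GkF ∘ xF
/-- Mode `P`: the phase function on `⟨x, ⟨register of the copy, layer register⟩⟩`. [folklore] -/
def PmodeF : List Bool → List Bool := GphaseF ∘ fanoutFn xF (fanoutFn qcF jF)
/-- Mode `Z`: the zero test on the three registers. [folklore] -/
def ZmodeF : List Bool → List Bool := GzF ∘ fanoutFn q0F (fanoutFn q1F q2F)

/-- **The function of the phase machine.** [cite: AaronsonAmbainis2018, §6 (p. 26)] -/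
def Fn : List Bool → List Bool := dispatchF WmodeF KmodeF PmodeF ZmodeF

/-- **`Fn ∈ FP`.** [cite: AroraBarak2009, §1.3] -/
theorem Fn_mem_FP : Fn ∈ FP :=
  dispatchF_mem_FP (comp_mem_FP GwF_mem_FP xF_mem_FP) (comp_mem_FP GkF_mem_FP xF_mem_FP)
    (comp_mem_FP GphaseF_mem_FP (fanoutFn_mem_FP xF_mem_FP (fanoutFn_mem_FP qcF_mem_FP jF_mem_FP)))
    (comp_mem_FP GzF_mem_FP (fanoutFn_mem_FP q0F_mem_FP (fanoutFn_mem_FP q1F_mem_FP q2F_mem_FP)))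

/-- A machine computing `Fn` in time `(n+2)^e`. [cite: AroraBarak2009, §1.3] -/
theorem exists_machine : ∃ (e : ℕ) (M : Turing.TM2ComputableAux Bool Bool), ∀ u : List Bool, M.OutputsWithin u (Fn u) (RevSim.Tn e u.length) :=
  RevClean.exists_outputsWithin_pow_of_mem_FP Fn_mem_FP

/-- **The parameters of the Forrelation phase-query family**: `8` spare query wires, no spare layer,
the function `Fn` and a machine for it. [cite: AaronsonAmbainis2018, §6 (p. 26)] -/
def params : Params where
  cW := 8
  cL := 0
  Fn := Fn
  e := Classical.choose exists_machine
  M := Classical.choose (Classical.choose_spec exists_machine)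
  hM := Classical.choose_spec (Classical.choose_spec exists_machine)

/-- The constants of `params`. [folklore] -/
theorem params_consts : params.cW = 8 ∧ params.cL = 0 := ⟨rfl, rfl⟩

/-- `Ly params N = N`, `Wq params N = N + 8`. [folklore] -/
theorem Ly_params (N : ℕ) : Ly params N = N ∧ Wq params N = N + 8 := ⟨rfl, rfl⟩

/-! ### The specification -/

/-- The phase predicate: input, register content, layer. [cite: AaronsonAmbainis2018, §6 (p. 26)] -/
def Pf (x u : List Bool) (j : ℕ) : Bool := decide (GphaseF (boolPair x (boolPair u (junary x.length j))) = [])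

/-- **The four equations of `Fn` on data words.** [folklore] -/
theorem Fn_wd (x : List Bool) (q : ℕ → List Bool) (hq : ∀ c, (q c).length = Wq params x.length) (jv cv : List Bool)
    (hjv : jv.length = Ly params x.length) (hcv : cv.length = 2) :
    Fn (wd x q jv cv [false, false]) = GwF x ∧ Fn (wd x q jv cv [true, false]) = GkF x ∧
    Fn (wd x q jv cv [true, true]) = GzF (boolPair (q 0) (boolPair (q 1) (q 2))) ∧
    ∀ c, c < 3 → cv = ccode c → Fn (wd x q jv cv [false, true]) = GphaseF (boolPair x (boolPair (q c) jv)) := by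
  obtain ⟨e1, e2, e3, e4⟩ := dispatchF_wd params x q jv hq hjv params_consts WmodeF KmodeF PmodeF ZmodeF cv hcv
  refine ⟨?_, ?_, ?_, fun c hc hcc => ?_⟩
  · rw [Fn, e1, WmodeF, Function.comp_apply, xF_wd]
  · rw [Fn, e2, KmodeF, Function.comp_apply, xF_wd]
  · obtain ⟨f0, f1, f2, -⟩ := qF_wd params x q jv cv [true, true] hq params_consts
    rw [Fn, e4, ZmodeF, Function.comp_apply, fanoutFn_apply, fanoutFn_apply, f0, f1, f2]
  · subst hcc
    rw [Fn, e3, PmodeF, Function.comp_apply, fanoutFn_apply, fanoutFn_apply, xF_wd, qcF_wd params x q jv hq hjv params_consts hc,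
      jF_wd params x q jv (ccode c) [false, true] hq hjv params_consts]

/-- **The specification of the Forrelation phase machine.** [cite: AaronsonAmbainis2018, §6 (p. 26)] -/
def spec : Spec params where
  Wv x := (GwF x).length
  Kv x := (GkF x).length
  Pf := Pf
  hW x := by
    show (Fn (wd x _ _ _ _)).length = _
    rw [(Fn_wd x (fun _ => zeros (Wq params x.length)) (fun _ => by simp [zeros]) (zeros (Ly params x.length)) (zeros 2)
      (by simp [zeros]) (by simp [zeros])).1]
  hK x := by
    show (Fn (wd x _ _ _ _)).length = _
    rw [(Fn_wd x (fun _ => zeros (Wq params x.length)) (fun _ => by simp [zeros]) (zeros (Ly params x.length)) (zeros 2)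
      (by simp [zeros]) (by simp [zeros])).2.1]
  hP x q hq j hj1 hjL c hc := by
    show Fn (wd x _ _ _ _) = [] ↔ _
    rw [(Fn_wd x q hq (junary (Ly params x.length) j) (ccode c) (by simp [junary]; omega) (by simp [ccode])).2.2.2 c hc rfl, Pf,
      decide_eq_true_iff, (Ly_params x.length).1]
  hZ x q hq := by
    show Fn (wd x _ _ _ _) = [] ↔ _
    rw [(Fn_wd x q hq (zeros (Ly params x.length)) (zeros 2) (by simp [zeros]) (by simp [zeros])).2.2.1, GzF_eq_nil_iff,
      hq 0, hq 1, hq 2]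
    constructor
    · rintro ⟨h0, h1, h2⟩ c hc
      interval_cases c <;> assumption
    · intro h; exact ⟨h 0 (by norm_num), h 1 (by norm_num), h 2 (by norm_num)⟩

end ForrMem

end Literature.Computability.QuantumComplexity
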